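import Mathlib
import HarnessLib
import HarnessLib.Audit
import Summits.BirchSwinnertonDyer.Statement
import HarnessLib.Audit.Check
import Literature.NumberTheory.EllipticCurves.Selmer
import Literature.NumberTheory.EllipticCurves.Sha
import Literature.NumberTheory.EllipticCurves.QuadraticTwist
import Literature.NumberTheory.EllipticCurves.GlobalMinimalModel
import Literature.NumberTheory.EllipticCurves.GaloisAction
import Literature.NumberTheory.EllipticCurves.Tamagawa
import Literature.NumberTheory.EllipticCurves.OrdinaryPrimes
import Literature.NumberTheory.DiophantineGeometry.Conductor
import Literature.NumberTheory.EllipticCurves.SelmerCorankHolds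
import Literature.NumberTheory.EllipticCurves.GlobalMinimalModelProofs
import Literature.NumberTheory.EllipticCurves.OrdinaryPrimesProofs
import Literature.NumberTheory.EllipticCurves.MinimalModelReduction
import Literature.NumberTheory.EllipticCurves.VariableChangePoints
import Literature.NumberTheory.DiophantineGeometry.LocalReductionProofs
import Literature.NumberTheory.DiophantineGeometry.MinimalModelUniquenessProofs
import Summits.BirchSwinnertonDyer.BirchSwinnertonDyer.Theorems.SelmerRankAssembly
import Summits.BirchSwinnertonDyer.BirchSwinnertonDyer.Theorems.SelmerRankShaCorank
import Literature.NumberTheory.EllipticCurves.Isogeny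
import HarnessLib.Audit.Status.Attr

/-!
Route: FrozenTwin

DORMANT since 2026-08-26T10:53:14Z (reconciler: no traction for 8.3 d (last activity item-evidence-added at 2026-08-18T02:23:11Z); parked, not closed — `ledger route dormant route-BirchSwinnertonDyer-FrozenTwin --off` to reactivate) — unstaffed, not closed; items shared with open routes are served there. `ledger route dormant <id> --off` reactivates.

# Route FrozenTwin — one integer caps the p-Selmer rank — a frozen rank-0 class-group twin reads UB
off a Gross-point moment

COMPUTATIONAL WITNESS (operator D). It suffices to show X = (CERT) ∧ (LB-side). (CERT) For every
elliptic E/ℚ (global minimal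
model) with a prime of multiplicative reduction there is ONE good ordinary big-image prime p ≥ 5
with corank_{ℤ_p} Sel_{p^∞}(E/ℚ) ≤
ord_{s=1} L(E,s), produced by a ONE-INTEGER CERTIFICATE: an imaginary quadratic K (definite
factorisation N = N⁺N⁻, p ∣ h_K, cyclic
p-Sylow ⟨σ⟩ of Cl_K) and an index k ≤ r_an(E) such that the k-th binomial class-group moment M_k =
Σ_{𝔞∈Cl_K} C(dlog_σ 𝔞, k)·φ_E(x_𝔞) ∈ ℤ
of the integral Jacquet–Langlands (Gross) vector φ_E over the Gross points x_𝔞 of K is prime to p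
(crux GrossMomentSharpness =
existence of the certificate; crux FrozenTwinBound = "p ∤ M_k ⇒ corank ≤ k", i.e. the 𝔓-adic
valuation v_𝔓(S_χ) = min{k : p ∤ M_k}
of ONE order-p class-group twist S_χ = Σ χ(𝔞)φ_E(x_𝔞) of the Gross–Waldspurger period caps the
p-Selmer rank). (LB-side) the
potentially-good sector, the lower bound r_an ≤ corank, p-primary Ш-finiteness and the CM sector are
the cruxes
UBPotentiallyGood / SelmerRankLB / SelmerRankShaPFinite / SelmerRankCM shared VERBATIM with routes
ToricShedding / SelmerRank /
TangentCone / ShadowIsolation (CM re-route 2026-08-17: the shared small-image crux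
SelmerRankSmallImage is no longer carried here —
the small-image primes of NON-CM curves are switched away inside `closes` by Serre's open image
theorem, support item
SerrePrimeSupply = tree theorem Theorems.exists_goodOrdinary_surjective_of_not_hasCM, and by
Ш-finiteness). Card realised: definite-class-group-gross-moment-certificate-v2 (spine; extended here
to both signs by the sum-versus-max
count, typed, given a sector split and a compute protocol).
Lean: `∀ (W : WeierstrassCurve ℚ) [W.IsElliptic] [W.IsGloballyMinimal], (∃ (q : ℕ) (_ : Fact
q.Prime), W.HasMultiplicativeReductionAtPrime q) → ∃ (p : ℕ) (_ : Fact p.Prime), 5 ≤ p ∧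
W.HasGoodReductionAtPrime p ∧ ¬ (p : ℤ) ∣ W.frobeniusTrace p ∧ W.HasSurjectiveModNGaloisRep p ∧
W.selmerCorank p ≤ W.analyticRank`

## Assembly
Bookkeeping over proved tree theorems, ALL inside the crux-only deciding theorem `closes :
GrossMomentSharpness → FrozenTwinBound →
UBPotentiallyGood → SelmerRankLB → SelmerRankShaPFinite → SelmerRankCM → SerrePrimeSupply →
BirchSwinnertonDyer` (rev 5; Sketch.lean,
lean check rc 0, axioms propext / Classical.choice / Quot.sound; the skeleton is route
ToricShedding's certified closes with the multiplicative branch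
replaced): for a global minimal model V (hasGlobalMinimalModel_rat_holds, proved) — if V has a
multiplicative prime, GrossMomentSharpness
gives (p, datum, k ≤ r_an, p ∤ M_k) and FrozenTwinBound gives corank_p ≤ k ≤ r_an, SelmerRankLB
gives equality; else, for a CM curve, a good
ordinary p ≥ 5 (exists_good_ordinary_prime_holds, proved) and SelmerRankCM give corank = r_an, and
for a non-CM curve the Serre
big-image good ordinary prime p ≥ 5 of SerrePrimeSupply with UBPotentiallyGood ∧ SelmerRankLB gives
corank = r_an; Greenberg's corank identity (selmerCorank_eq_mordellWeilRank_add_holds, proved),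
shaCorank = 0 from SelmerRankShaPFinite
(Literature.BSD.shaCorank_eq_zero_of_finite) and isomorphism invariance of rank / Euler factors /
analytic rank (re-derived inline, AEC
III.3.1(b), VII.1.3, App. C §16) transport rank = r_an to every model
(Literature.BSD.selmerCorank_identity_imp_thesis_imp_bsd).

Rationale: WHY THIS LINE. Mechanism (three printed levers, one new junction): (i) FREEZING (MazurRubin2007 =
arXiv:math/0512085, Prop 1.3/Thm 1.4 with empty
exceptional set): for L/K unramified cyclic of degree p (L inside the Hilbert class field, p ∣ h_K)
the (p−1)-dimensional twin
A_χ = ker(Res_{L/K}E → E) has A_χ[𝔓] = E[p] and, under the side conditions (Raynaud at v ∣ p,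
H¹(K_v,E[p]) = 0 at v ∣ N), literally
the same Selmer conditions, so Sel_𝔓(A_χ/K) = Sel_p(E/K) = Sel_p(E/ℚ) ⊕ Sel_p(E^{D_K}/ℚ); (ii)
DOUBLING: the twin has analytic rank
ZERO (w(E/K,χ) = +1 in the definite setting), so M := Sel_{𝔓^∞}(A_χ/K) = Ш(A_χ/K)[𝔓^∞] is finite and
carries the perfect
skew-Hermitian Cassels–Tate–Flach form (MazurRubin2007 App. A) whose 𝔽_p-shadow on M[𝔓] is
ANTI-invariant under complex conjugation
(ι(π) ≡ −π on 𝔓^{-1}/𝒪): its radical M[𝔓] ∩ 𝔓M has dimension ≥ |s⁺ − s⁻| (the linear algebra of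
Literature.Barriers.BirchSwinnertonDyer.AnticyclotomicHeightDegeneracy, used as an ENGINE), hence
length_𝒪 M ≥ 2·max(s_p(E), s_p(E^D));
(iii) RANK-0 EXACTNESS: in analytic rank 0 the length of an anticyclotomic Selmer group IS twice the
valuation of a toric period
(Kim2024 Thm 5.23 at trivial character; BertoliniDarmon2005, Nekovář doi:10.4153/cjm-2011-077-6,
Longo–Vigni arXiv:0806.4267;
Gross1987 §11 for L(E/K,χ,1) = c·|S_χ|²), so length M ≤ 2·v_𝔓(S_χ) and dim_{𝔽_p} Sel_p(E/ℚ) ≤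
v_𝔓(S_χ) = min{k : p ∤ M_k}. The rank-r
problem for E is thus moved into the LENGTH of a rank-0 object, where exact formulas exist; what
remains (GrossMomentSharpness) is a
HORIZONTAL mod-p non-vanishing statement for CM-point sums on a finite set — a genre with theorems
(Michel doi:10.4007/annals.2004.160.185
equidistribution of Gross points; CornutVatsal2007; Burungale–Hida–Tian arXiv:1712.02148) and with a
per-curve certificate a laptop
checks (card data, kit j010059: 389a1, p ∈ {5,7}, ten fields, M_0 = 0, M_1 ≡ 0, M_2 ≢ 0 in 10/10).
Imported areas: arithmetic of
Selmer twisting / local constants (MR), Cassels–Tate–Flach dualities, definite Shimura sets (Gross,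
BD), equidistribution of CM
points (ergodic/analytic). What no listed route does: ToricShedding (nearest) varies the FORM
(admissible level raising at depth
r_an(E)+r_an(E^K)) at trivial character and converts through Kim's Kolyvagin-system structure
theorem; here the form is FIXED, the
depth is the 𝔓-adic order in the CLASS-GROUP character direction at p ∣ h_K (where no ℤ_p-tower,
branch decomposition or bipartite
derivative exists), and the conversion is freezing + anti-invariant doubling + a rank-0 BSD-length;
SelmerRank / PAdicOrderV2 /
LeadingTerm are cyclotomic-Iwasawa, HigherGrossZagier and Squeeze use heights resp. no mechanism,
ShadowIsolation uses congruences of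
forms. Negatives index: the one refuted statement (LeadingTerm TamePinch, CM curves have no
admissible p) is steered around — CM
curves have integral j, hence no multiplicative prime, and sit in SelmerRankCM.

RANKED CRUXES. #2 GrossMomentSharpness (crux) — CERTIFICATE EXISTENCE (card K1, both signs). For
every elliptic E/ℚ (globally minimal W) with a prime of multiplicative reduction there are: a prime
p ≥ 5 (good ordinary, ρ̄_{E,p} surjective, p ∤ q²−1 for q ∣ N, p ∤ v_q(j) at multiplicative q), a
definite factorisation N = N⁺N⁻ (N⁻ square-free, odd number of primes) realised by an imaginary
quadratic K (d_K < −4, (d_K, Np) = 1, N⁺-primes split, N⁻-primes inert) with p ∣ h_K and CYCLIC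
p-Sylow ⟨σ⟩ of Cl_K (order p^m) with discrete logarithm dlog, the definite quaternion algebra B =
(a,b)_ℚ ramified exactly at N⁻, an Eichler order O of level N⁺, its invertible right ideals RI, an
INTEGER-valued B^×-invariant Hecke eigenfunction φ on RI with T_q φ = a_q(E) φ (q ∤ N) and φ ≢ 0 mod
p (the Gross / Jacquet–Langlands vector, Kim2024 function convention as in ToricShedding), a
conductor-1 Gross point (ψ, I) of K with its Pic(O_K)-orbit ψ(𝔞)I — and an index k ≤
ord_{s=1}L(E,s), k ≤ p−2, such that the binomial moment M_k = Σ_{𝔞 ∈ Cl_K} C(dlog 𝔞, k)·φ(ψ(𝔞)I) is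
NOT divisible by p. (Equivalently v_𝔓(S_χ) ≤ r_an(E) for the order-p class-group twist S_χ = Σ_k
(−π)^k M_k, π = 1 − ζ_p^{-1}; the existential automatically selects K with s_p(E^{D_K}) ≤ r_an(E):
r_an(E^D) = 0 for w = +1, = 1 for w = −1.) Compute protocol (first job of the route, one batched
kit/PARI job extending the card's gross_moments.gp): supersingular j mod N⁻-data / Brandt module via
Φ_2, Φ_3, integral eigenvector, roots of H_{d_K} walked by Φ_q, moments M_0..M_4 mod p for (389a1,
433a1, 446d1, 563a1, 571b1, 5077a1 [w=−1, r=3], 37a1 [w=−1, r=1], 11a1/14a1 [r=0]) × all K with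
|d_K| ≤ 3000, N⁻ inert, p ∈ {5,7,11} ∣ h_K: predicted M_j ≡ 0 (j < r_an), and M_{r_an} ≢ 0 for a
positive proportion of admissible K. [difficulty: open-problem] (why it might fail: M_k are
class-group-direction Taylor coefficients of the definite theta element; accidental zeros of L(E,s)
might push θ_K deeper into the augmentation ideal for EVERY admissible K (beyond BD96 Conj 4.1's
max(r̃⁺,r̃⁻)), or every twin's Ш carries extra 𝔓-length; odd sign untested.) [Gross1987,
BertoliniDarmon1996, MazurRubin2007, CornutVatsal2007, doi:10.4007/annals.2004.160.185,
arXiv:1712.02148, arXiv:2306.17784, Kim2024]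
#3 FrozenTwinBound (crux) — ONE INTEGER CAPS THE SELMER CORANK (card K2 + P2 + P3, both signs). For
every elliptic E/ℚ (globally minimal W) and every admissible datum as in GrossMomentSharpness (same
side conditions, universally quantified) and every k ≤ p − 2: if p ∤ M_k then corank_{ℤ_p}
Sel_{p^∞}(E/ℚ) ≤ k. Intended proof: p ∤ M_k with k ≤ p−2 ⇒ v := v_𝔓(S_χ) = min{j : p ∤ M_j} ≤ k and
S_χ ≠ 0 ⇒ L(E/K,χ^i,1) ≠ 0 for all i (Gross–Waldspurger, Galois-conjugate values) ⇒ the unramified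
order-p twin A_χ/K has Mordell–Weil rank 0 and M = Sel_{𝔓^∞}(A_χ/K) = Ш(A_χ/K)[𝔓^∞] finite (BD2005 /
Longo–Vigni / Nekovář) with length_𝒪 M ≤ 2v (rank-0 𝔓-part of BSD, upper bound = Euler-system
direction; Kim2024 Thm 5.23 is the trivial-character prototype: length = 2·v_p(toric period));
freezing (MR Prop 1.3: Raynaud at v ∣ p since p ≥ 5 unramified in K, H¹(K_v,E[p]) = 0 at v ∣ N from
p ∤ (q²−1)·v_q(j), E(L)[p] = 0 from surjectivity) gives M[𝔓] = Sel_p(E/K) = Sel_p(E/ℚ) ⊕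
Sel_p(E^{D_K}/ℚ) =: V⁺ ⊕ V⁻; the Cassels–Tate–Flach form on M is perfect skew-Hermitian and
Gal(K/ℚ)-equivariant with c acting on 𝒪 = ℤ[ζ_p] by ι, and ι ≡ −1 on 𝔓^{-1}𝒪/𝒪, so its shadow b on
M[𝔓] satisfies b(cx,cy) = −b(x,y): V⁺, V⁻ are b-isotropic, rad b = M[𝔓] ∩ 𝔓M has 𝔽_p-dimension ≥
|s⁺−s⁻|, i.e. at least |s⁺−s⁻| cyclic factors of M have exponent ≥ 2 and length M ≥ (s⁺+s⁻) +
|s⁺−s⁻| = 2·max(s⁺,s⁻). Hence dim_{𝔽_p} Sel_p(E/ℚ) = s⁺ ≤ v ≤ k, and corank ≤ dim Sel_p − dim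
E(ℚ)[p] ≤ k. [difficulty: L] (why it might fail: Rank-0 bound length Ш(A_χ/K)[𝔓^∞] ≤ 2v_𝔓(S_χ) at 𝔓
∣ p = ord χ, p ∣ h_K, is unprinted (LV2010 1.2 excludes 𝔓 ∣ L_alg; Kim2024 5.23 has trivial χ; BCK
drop the torsion of G̃_∞); an inline side condition (Eichler/RI, embedding, T_q typing) may
mis-state — then misstated, not false.) [MazurRubin2007, Kim2024, BertoliniDarmon2005,
arXiv:0806.4267, doi:10.4153/cjm-2011-077-6, ChidaHsieh2014, PollackWeston2011, arXiv:2601.14504]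
#4 UBPotentiallyGood (crux) — shared verbatim with route ToricShedding (its crux #5): the
POTENTIALLY-GOOD SECTOR (no prime of multiplicative reduction, i.e. integral j — the definite
setting needs an odd number of inert multiplicative primes): for such E (globally minimal W) and
every good ordinary p ≥ 5 with ρ̄ surjective, corank Sel_{p^∞}(E/ℚ) ≤ r_an(E). [difficulty:
open-problem] (why it might fail: It is SelmerRankUB on the integral-j class: open from corank 4
exactly as there; no definite Gross-point setting exists for these curves (ε(E/K) = −1 for every
coprime imaginary K when all conductor exponents are even), so the certificate has no grip.)
[Zhang2014, Kato2004, SkinnerUrban2014, BurungaleEtAl2026]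
#5 SelmerRankLB (crux) — shared verbatim with routes SelmerRank / ToricShedding: for p ≥ 5 good
ordinary with ρ̄_{E,p} surjective (global minimal model), ord_{s=1} L(E,s) ≤ corank Sel_{p^∞}(E/ℚ).
[difficulty: open-problem] (why it might fail: Theorem for r_an ≤ 3 (BCS2025 1.1.2,
BurungaleEtAl2026 Cor 1, p-parity); OPEN from r_an = 4: needs Selmer classes out of high-order
vanishing; the certificate side only produces UPPER bounds.) [BurungaleEtAl2026, SkinnerUrban2014,
Kato2004, arXiv:2412.20078]
#6 SelmerRankShaPFinite (crux) — shared verbatim with routes SelmerRank / ToricShedding: p-primary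
Tate–Shafarevich finiteness, Ш(E/ℚ)[p^∞] finite for every elliptic E/ℚ and every prime p.
[difficulty: open-problem] (why it might fail: Known only for r_an ≤ 1 (Kolyvagin1990 Thm A,
Kato2004 Thm 14.2); for r_an ≥ 2 nothing excludes an infinitely divisible element of Ш at every p;
the certificate kills Ш(E)[p] only at sharp (K,p), not at every p.) [Kolyvagin1990, Kato2004,
SilvermanAEC2009, GreenbergLNM1716]
#7 SelmerRankCM (crux, rank 8) — CM SECTOR, shared verbatim with routes SelmerRank / ToricShedding /
TangentCone / ShadowIsolation (stmt-18086; the 2026-08-17 re-route of the shared small-image crux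
SelmerRankSmallImage, stmt-14418, which THIS route dropped at rev 5): for E/ℚ WITH complex
multiplication (globally minimal W, W.HasCM) and every prime p ≥ 5 of good ordinary reduction (the
primes split in the CM field), corank_{ℤ_p} Sel_{p^∞}(E/ℚ) = ord_{s=1} L(E,s). Known slices: r_an ≤
1 (Coates–Wiles, Rubin, GZK), corank_p ≤ 1 (Burungale–Tian p-converses), parity
(Dokchitser–Dokchitser 1.4). [difficulty: open-problem] (why it might fail: open once min(corank_p,
r_an) ≥ 2 — Rubin's two-variable IMC bounds corank_p only by the order of a Katz p-adic L whose
comparison with r_an needs a non-degenerate CM p-adic height (Bertrand1982 = rank 1); r_an ≤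
corank_p beyond p-parity has no engine.) [Rubin1991MainConj, CoatesWiles1977, Rubin1987Sha,
arXiv:2506.03465, doi:10.1007/s00222-019-00929-7, DokchitserDokchitserAnnals2010,
doi:10.5802/aif.2206] PRIME SWITCH (why the small-image sector of NON-CM curves costs nothing more):
a non-CM curve has a good ordinary big-image prime q ≥ 5 (Serre 1972 §4.2 Thm 2 + infinitely many
good ordinary primes — support item SerrePrimeSupply, rank 9, PROVED in tree as
Theorems.exists_goodOrdinary_surjective_of_not_hasCM from serre_open_image_holds +
infinite_goodOrdinaryPrimes_holds; closable in one line; kept as an ITEM, not an import, so the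
route file's import cone stays at 79 modules), where the certificate (multiplicative sector) resp.
UBPotentiallyGood (integral j) with SelmerRankLB give corank_q = r_an, and SelmerRankShaPFinite
makes the corank prime-independent (Greenberg's identity); so SelmerRankSmallImage is a corollary of
this route's hypotheses (planner Sketch.lean smallImage_of_newBinders, lean rc 0).

TWO-LAYER PLAN. Once FrozenTwinBound is attacked: FrozenTwinBound ⇐ Freezing → Doubling →
RankZeroLength → FrozenTwinBound (k = 3, depth 1), with Freezing =
Sel_𝔓(A_χ/K) = Sel_p(E/K) under the side conditions (provable from MR Prop 1.3 + Raynaud once the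
twin A_χ is a tree notion),
Doubling = length ≥ 2·max(s⁺,s⁻) (Cassels–Tate–Flach + the anti-equivariant linear algebra already
proved in
Literature.Barriers.BirchSwinnertonDyer.AnticyclotomicHeightDegeneracy), RankZeroLength = length_𝒪
Ш(A_χ/K)[𝔓^∞] ≤ 2 v_𝔓(S_χ) (the
literature-adjacent leaf). GrossMomentSharpness ⇐ EvenSign (s⁻ = 0) → OddSign (s⁻ = 1) →
GrossMomentSharpness once the compute job
shows which sign carries the difficulty.

KILL CRITERIA. Refutation of FrozenTwinBound by ONE admissible (E, p, K, χ, k ≤ p−2) with p ∤ M_k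
and certified corank_p(E) > k (e.g. k+1 independent
points) closes the route outright (close --reason refuted:FrozenTwinBound) unless the witness
exploits a mis-typed side condition
(then restate 1:1). GrossMomentSharpness is killed for the line (pivot to the indefinite face, card
class-group-twin-cassels-tate-ladder-v4,
or retire) if the batched job finds M_{r_an} ≡ 0 mod p for EVERY admissible K tried (≥ 30 fields
over ≥ 3 curves incl. one odd-sign
curve) while lower moments behave as predicted. A proof of SelmerRankUB (route SelmerRank #3) at
every big-image ordinary prime moots
the certificate half; a refutation of SelmerRankShaPFinite, SelmerRankLB or SelmerRankCM breaks this
route together with SelmerRank / ToricShedding /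
TangentCone / ShadowIsolation.

NOT DECOMPOSED YET. Freezing, Doubling and the rank-0 length bound are NOT filed as items: the twin
A_χ, the Cassels–Tate–Flach form and Ш of an abelian
variety over K are not tree notions (definition requests below); they are layer-2 children of
FrozenTwinBound. The valuation identity
v_𝔓(S_χ) = min{k ≤ p−2 : p ∤ M_k} (card P1, elementary: v_𝔓(π) = 1, v_𝔓(p) = p−1) is folded into the
two typed cruxes by stating
them directly on the integers M_k. The supply of admissible (K, p) (imaginary quadratic fields with
prescribed splitting at the primes
of N and class number divisible by a large good ordinary surjective p) is part of
GrossMomentSharpness, not a separate item. IMPORT-CONE FACT (cone repair 2026-08-16):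
the route's project import cone (79 modules) carries exactly ONE unproved named fact,
WeierstrassCurve.hasEntireLFunction_rat
(Literature/NumberTheory/EllipticCurves/AnalyticRank.lean:176; modularity ⇒ L(E,s) entire, Wiles1995
/ BCDTJAMS2001 Thm A; size XL).
It rides in through Summits/BirchSwinnertonDyer/BirchSwinnertonDyer/Statement.lean itself —
WeierstrassCurve.analyticRank :=
analyticOrderNatAt W.entireLFunction 1 lives in that same file and is a junk value (entireLFunction
:= W.LSeries) without it — so it
lies in the module cone of EVERY route of this summit: no import of this route can be dropped to
shed it (the planner imports are
identical to those of the READY route ToricShedding) and no crux can be restated around it, since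
GrossMomentSharpness (k ≤ analyticRank
with p ∤ M_k) and every UB statement are unprovable for a positive-rank curve until its L-function
is known entire. It is GENUINELY
NEEDED — needs-fact: WeierstrassCurve.hasEntireLFunction_rat — owed by the eventual PROOFS of
GrossMomentSharpness / UBPotentiallyGood /
SelmerRankCM, never a hypothesis of an item or of `closes` (naming it in a decl would move the
unproved constant into the
used-constants cone, which is 0/82 unproved at open). In tree it is already reduced sorry-free to
modularity:
hasEntireLFunction_rat_of_exists_isNewformOf (AnalyticRankModularityProofs.lean),
hasEntireLFunction_rat_of_theoremB_of_CDT
(AnalyticRankBCDTProofs.lean), hasEntireLFunction_rat_of_khare_wintenberger_of_CDT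
(AnalyticRankKhareWintenbergerProofs.lean); what
remains is the Modularity Theorem itself. The support marker EntireContinuation (rank 9; body the
unfolded statement
∀ W [W.IsElliptic], W.HasEntireLFunction, Iff.rfl-equal to the fact; the same item as route
Squeeze's, stmt-BirchSwinnertonDyer-1068)
records the debt on this route and closes in one line once
WeierstrassCurve.hasEntireLFunction_rat_holds lands.

CHEAPEST FALSIFIER. (i) LOOKUP done: Longo–Vigni arXiv:0806.4267 Thm 1.2 (READ pp. 1–3) is an
indivisibility theorem that EXCLUDES 𝔓 ∣ L_alg — it neither
proves nor contradicts FrozenTwinBound, confirming K2 is a genuine (rank-0, Euler-system-direction)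
crux; LRV arXiv:1004.3424 (READ
pp. 1–3) shows the real-quadratic analogue would be conditional on Darmon-point rationality — which
is why the route stays imaginary/definite.
(ii) COMPUTATION (card, kit j010059, not re-run here — hub is compute-free and the GP script lives
in the card author's folder): 389a1,
p = 5 (d_K ∈ {−47,−103,−227,−571,−739,−1051}) and p = 7 (d_K ∈ {−71,−151,−1787,−2179}): [M_0, M_1,
M_2] ≡ [0, 0, ≠0] in 10/10, sharp
(v = 2 = s_5 = s_7) in 7/7 fields with L(E^D,1) a p-unit — consistent with FrozenTwinBound (corank 2
≤ 2) and with GrossMomentSharpness.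
(iii) NEXT (first staffed compute job, specified in crux #2): the odd-sign prediction on 37a1 (M_0 =
0 exactly, M_1 ≢ 0 for some K) and
5077a1 (M_1 ≡ M_2 ≡ 0, M_3 ≢ 0 for some K with s_p(E^D) = 1); ONE 37a1-field with M_0 ≠ 0, or one
rank-0 curve/field with p ∣ M_0 but
L(E/K,1)_alg a p-unit, kills the normalisation; corank-vs-k violations kill FrozenTwinBound.

NUMBERS. r_an ≤ 3 is the proved range of SelmerRankLB (BCS2025 Thm 1.1.2); the certificate is the
first mechanism on the board whose instance at
(rank 4, w = +1) is a single integer: M_4 mod p for the rank-4 curve 234446a1 needs N⁻ ∈ {2, 117223,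
…} inert — 234446 = 2·117223, so
K with 2 inert, 117223 split (or vice versa), p ∣ h_K, p ≥ 5 good ordinary surjective. Card data:
#SS_389 = 33 supersingular points,
h_K = p ∈ {5, 7} for the ten fields used. Items after the cone repair: 8 (6 cruxes, 1 support marker
EntireContinuation, 1 assembly);
used-constants cone 0 unproved of 82 project constants (at open); module cone 1 unproved named fact
(hasEntireLFunction_rat,
Statement-borne, needs-fact). Items after the CM re-route (rev 5, 2026-08-17): 9 (6 cruxes
GrossMomentSharpness / FrozenTwinBound /
UBPotentiallyGood / SelmerRankLB / SelmerRankShaPFinite / SelmerRankCM, 2 supports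
EntireContinuation + SerrePrimeSupply, 1 assembly);
used-constants cone 0 unproved of 89; import cone unchanged (79 modules; importing
SerreOpenImageFinalProofs instead would have added 366).

DEFINITION REQUESTS. - UnramifiedTwin (Literature/NumberTheory/EllipticCurves): for E/K and an
unramified cyclic L/K of prime degree p, the abelian variety A_χ = ker(N : Res_{L/K} E_L → E) with
its 𝒪 = ℤ[ζ_p]-action, A_χ[𝔓] ≅ E[p] (MazurRubin2007 §3) — needed to file Freezing / Doubling as
layer-2 items.
- CasselsTateFlachForm: the perfect skew-Hermitian pairing on Ш(A_χ/K)[𝔓^∞]/div (MazurRubin2007 App.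
A, Flach 1990) — same purpose.
- fact wanted (cite): Gross–Waldspurger–Zhang special value formula L(E/K,χ,1) = c(E,K)·|Σ_𝔞 χ(𝔞)
φ_E(x_𝔞)|² with c ≠ 0 for ring-class χ in the (N⁺, N⁻) definite setting (Gross1987 §11 Prop 11.2 for
prime N; Zhang2001 / ChidaHsieh2014 in general) — the tree's GrossPointsThetaElement.lean records it
as a documented gap.
- needs-fact: WeierstrassCurve.hasEntireLFunction_rat
(Literature/NumberTheory/EllipticCurves/AnalyticRank.lean) — GENUINELY NEEDED,
Statement-borne, not re-routable; tier-0 Literature debt (the Modularity Theorem; in-tree reductions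
listed under NOT DECOMPOSED YET);
route-side marker = support item EntireContinuation.

Novelty: Searches (2026-08-16): `lit frontier BirchSwinnertonDyer --since 2024` (30 rows; arXiv:2601.14504
Castella–Sano READ pp.1–3: twist-near-trivial divisibility index for Kato/Heegner systems;
arXiv:2306.17784 BCK); `lit search --source arxiv` ×7 ("analytic rank certification…" 0, "refined
nonvanishing conjectures Kurihara Kolyvagin" 1, "Selmer group unramified twist class group character
… L-value" 0, "Gross points nonvanishing mod p toric periods horizontal" 0, "Cassels-Tate pairing
cyclotomic twist skew-Hermitian Selmer parity" 0, "horizontal non-vanishing Heegner points toric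
periods mod p" 0, "Burungale Hida Andre-Oort" 0); `lit search --source zbmath` ×6 (Darmon points/LRV
6 hits → arXiv:1004.3424 READ; Longo–Vigni → arXiv:0806.4267 READ; Nekovář CJM 2012 READ pp.1–3;
Michel Annals 160; BHT arXiv:1712.02148; André–Oort/Hecke-orbit 0); `lit galaxy search --star all`
×4 ("local constants Selmer twisting order p unramified" 0, "theta element Gross points class group
order of vanishing" 0, "Finding large Selmer rank" 1 irrelevant, "special values of anticyclotomic
L-functions modulo" 0) + `--star pdf` "class number divisible by p" (2, Gras); hub: all 8 route
files of the sub (headers + items), 151 idea cards (titles; 9 read in full), negatives index (1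
entry), barrier catalogue (10 entries).
Nearest prior art found: BertoliniDarmon1996 Conj 4.1 (order of vanishing of the definite theta
element over ring-class groups = max(r̃⁺, r̃⁻): the n = 0, p ∣ h_K layer is our inequality +  [refs: 10.4153/cjm-2011-077-6, 2601.14504, 2306.17784, 1004.3424, 0806.4267, 1712.02148, doi:10.4153/cjm-2011-077-6, BertoliniDarmon1996, MazurRubin2007, Kim2024]

Barriers (technique_class: selmer-twisting, cassels-tate, gross-points, certificate): - technique_class: selmer-twisting, cassels-tate, gross-points, certificate
- Literature.Barriers.BirchSwinnertonDyer.AnticyclotomicHeightDegeneracy: MET AND USED — the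
anti-invariance that degenerates anticyclotomic heights (nullity ≥ |r₊ − r₋|, `finrank_plusPart_le`)
is exactly what DOUBLES the twin's Ш-length here; the bound needs no regulator, so degeneracy costs
nothing and supplies the factor 2.
- Literature.Barriers.BirchSwinnertonDyer.SelmerRankBarrier: conceded and respected — the
certificate bounds dim Sel_p(E/ℚ) = r_MW + dim Ш[p] (+0), i.e. it is an UPPER bound through a Selmer
group; no point is produced, LB is the shared crux SelmerRankLB; the barrier's content (Sel cannot
give LB in rank ≥ 2) is why the route is UB-sided by design.
- Literature.Barriers.BirchSwinnertonDyer.HeegnerPointBarrier: not met — no Heegner point, no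
Shimura-curve parametrisation, no construction of points; Gross points are CM points on a definite
Shimura SET and enter only through VALUES.
- Literature.Barriers.BirchSwinnertonDyer.NumericalVanishingBarrier: evaded — every quantity is an
exact integer (M_k) or an element of ℤ[ζ_p]; r_an(E) ≥ r enters GrossMomentSharpness only as the
hypothesis k ≤ analyticRank, never as a numerically certified vanishing; the certificate certifies
the Σ₁ side (p ∤ M_k), which is the decidable direction (`ne_zero_iff_exists_certificate`).
- Literature.Barriers.BirchSwinnertonDyer.FunctionalEquationSeesOnlyParity: respected — the only
functional equation used

History (route lifecycle, newest last):
- 2026-08-17T09:19:40Z · rev 5: restated Assembly (stmt-BirchSwinnertonDyer-17174) — route-repair (rrepair-db3f67d4, repair_kind=unused-crux, gen 1): SelmerRankCM (stmt-18086) GLUED INTO closes as a binder — the CM re-route that rchoice-de55961e (planner-rrepair-BirchSwinnertonDyer-FrozenTwin-db3f67d4-0)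
- 2026-08-17T09:19:40Z · rev 5: dropped SelmerRankSmallImage — route-repair (rrepair-db3f67d4, repair_kind=unused-crux, gen 1): SelmerRankCM (stmt-18086) GLUED INTO closes as a binder — the CM re-route that rchoice-de55961e (planner-rrepair-BirchSwinnertonDyer-FrozenTwin-db3f67d4-0)
- 2026-08-26T10:53:14Z · DORMANT — reconciler: no traction for 8.3 d (last activity item-evidence-added at 2026-08-18T02:23:11Z); parked, not closed — `ledger route dormant route-BirchSwinnertonD (operator:999:2497506)

sub-problem: BirchSwinnertonDyer · status: dormant · opened planner-plan-novel-BirchSwinnertonDyer-BirchSwi-5bb0a642-d-v2-g13-0 2026-08-16T22:44:43Z · rev 6 · ledger route-BirchSwinnertonDyer-FrozenTwin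
GENERATED by the gate from the ledger (D-0016/17). Provers cite these decls: `theorem foo : Summit.BirchSwinnertonDyer.BirchSwinnertonDyer.Theses.FrozenTwin.<Decl> := …` in Summits/BirchSwinnertonDyer/BirchSwinnertonDyer/Theorems/<Name>.lean.
-/

namespace Summit.BirchSwinnertonDyer.BirchSwinnertonDyer.Theses.FrozenTwin

open scoped BigOperators Topology Manifold Classical MeasureTheory ProbabilityTheory Matrix InnerProductSpace ComplexConjugate ContinuousMap
open Filter Set Function TopologicalSpace MeasureTheory

attribute [summit_statement] _root_.BirchSwinnertonDyer

open Literature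

/-- item stmt-BirchSwinnertonDyer-17172 · crux · rank 2 · open · by planner
why it might fail: M_k are class-group-direction Taylor coefficients of the definite theta element; accidental zeros of L(E,s) might push θ_K deeper into the augmentation ideal for EVERY admissible K (beyond BD96 Conj 4.1's max(r̃⁺,r̃⁻)), or every twin's Ш carries extra 𝔓-length; odd sign untested.
sources: Gross1987, BertoliniDarmon1996, MazurRubin2007, CornutVatsal2007, doi:10.4007/annals.2004.160.185, arXiv:1712.02148
[crux] CERTIFICATE EXISTENCE (card K1, both signs). For every elliptic E/ℚ (globally minimal W) with
a prime of multiplicative reduction there are: a prime p ≥ 5 (good ordinary, ρ̄_{E,p} surjective, p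
∤ q²−1 for q ∣ N, p ∤ v_q(j) at multiplicative q), a definite factorisation N = N⁺N⁻ (N⁻
square-free, odd number of primes) realised by an imaginary quadratic K (d_K < −4, (d_K, Np) = 1,
N⁺-primes split, N⁻-primes inert) with p ∣ h_K and CYCLIC p-Sylow ⟨σ⟩ of Cl_K (order p^m) with
discrete logarithm dlog, the definite quaternion algebra B = (a,b)_ℚ ramified exactly at N⁻, an
Eichler order O of level N⁺, its invertible right ideals RI, an INTEGER-valued B^×-invariant Hecke
eigenfunction φ on RI with T_q φ = a_q(E) φ (q ∤ N) and φ ≢ 0 mod p (the Gross / Jacquet–Langlands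
vector, Kim2024 function convention as in ToricShedding), a conductor-1 Gross point (ψ, I) of K with
its Pic(O_K)-orbit ψ(𝔞)I — and an index k ≤ ord_{s=1}L(E,s), k ≤ p−2, such that the binomial moment
M_k = Σ_{𝔞 ∈ Cl_K} C(dlog 𝔞, k)·φ(ψ(𝔞)I) is NOT divisible by p. (Equivalently v_𝔓(S_χ) ≤ r_an(E) for
the order-p class-group twist S_χ = Σ_k (−π)^k M_k, π = 1 − ζ_p^{-1}; the existential automatically
selects K with s_p(E^ -/
@[route_item "route-BirchSwinnertonDyer-FrozenTwin", crux]
def GrossMomentSharpness : Prop :=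
  ∀ (V : WeierstrassCurve ℚ) [V.IsElliptic] [V.IsGloballyMinimal], (∃ (q : ℕ) (_ : Fact q.Prime), V.HasMultiplicativeReductionAtPrime q) → ∃ (p : ℕ) (_ : Fact p.Prime) (Nplus Nminus m : ℕ) (a b : ℚ) (O : Subring (QuaternionAlgebra ℚ a 0 b)) (K : Type) (_ : Field K) (_ : NumberField K) (ψ : K →ₐ[ℚ] QuaternionAlgebra ℚ a 0 b) (I : Submodule ℤ (QuaternionAlgebra ℚ a 0 b)) (φ : Submodule ℤ (QuaternionAlgebra ℚ a 0 b) → ℤ) (rep : ClassGroup (NumberField.RingOfIntegers K) → nonZeroDivisors (Ideal (NumberField.RingOfIntegers K))) (RI : Set (Submodule ℤ (QuaternionAlgebra ℚ a 0 b))) (σ : ClassGroup (NumberField.RingOfIntegers K)) (dlog : ClassGroup (NumberField.RingOfIntegers K) → ℕ), ((5 ≤ p ∧ V.HasGoodReductionAtPrime p ∧ ¬ (p : ℤ) ∣ V.frobeniusTrace p ∧ V.HasSurjectiveModNGaloisRep p ∧ (∀ q : ℕ, q.Prime → q ∣ V.conductorNorm ℤ → ¬ (p : ℤ) ∣ (q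 : ℤ) ^ 2 - 1) ∧ (∀ (q : ℕ) (_ : Fact q.Prime), V.HasMultiplicativeReductionAtPrime q → ¬ (p : ℤ) ∣ padicValRat q V.j)) ∧ (Module.finrank ℚ K = 2 ∧ NumberField.IsTotallyComplex K ∧ NumberField.discr K < -4 ∧ Int.gcd (NumberField.discr K) (V.conductorNorm ℤ * p) = 1) ∧ (V.conductorNorm ℤ = Nplus * Nminus ∧ Nat.Coprime Nplus Nminus ∧ Squarefree Nminus ∧ Odd Nminus.primeFactors.card ∧ (∀ q : ℕ, q.Prime → q ∣ Nplus → ((Ideal.span {(q : ℤ)}).primesOver (NumberField.RingOfIntegers K)).ncard = 2) ∧ (∀ q : ℕ, q.Prime → q ∣ Nminus → ((Ideal.span {(q : ℤ)}).primesOver (NumberField.RingOfIntegers K)).ncard = 1)) ∧ (a < 0 ∧ b < 0 ∧ (∀ (q : ℕ) [Fact q.Prime], (∀ x : QuaternionAlgebra ℚ_[q] (a : ℚ_[q]) 0 (b : ℚ_[q]), x ≠ 0 → IsUnit x) ↔ q ∣ Nminus)) ∧ (∃ O₁ O₂ : Subring (QuaternionAlgebra ℚ a 0 b), (∀ S : Subring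 (QuaternionAlgebra ℚ a 0 b), (S = O₁ ∨ S = O₂) → (S.toAddSubgroup.FG ∧ (∀ d : QuaternionAlgebra ℚ a 0 b, ∃ n : ℤ, n ≠ 0 ∧ n • d ∈ S) ∧ ∀ S' : Subring (QuaternionAlgebra ℚ a 0 b), S'.toAddSubgroup.FG → S ≤ S' → S' = S)) ∧ O = O₁ ⊓ O₂ ∧ O.toAddSubgroup.relIndex O₁.toAddSubgroup = Nplus) ∧ (∀ J : Submodule ℤ (QuaternionAlgebra ℚ a 0 b), J ∈ RI ↔ (J.FG ∧ (∀ d : QuaternionAlgebra ℚ a 0 b, ∃ n : ℤ, n ≠ 0 ∧ n • d ∈ J) ∧ (∀ x : QuaternionAlgebra ℚ a 0 b, (∀ y ∈ J, y * x ∈ J) ↔ x ∈ O) ∧ (∃ J' : Submodule ℤ (QuaternionAlgebra ℚ a 0 b), (∀ x : QuaternionAlgebra ℚ a 0 b, x ∈ J * J' ↔ ∀ y ∈ J, x * y ∈ J) ∧ (∀ x : QuaternionAlgebra ℚ a 0 b, x ∈ J' * J ↔ x ∈ O)))) ∧ ((∀ J ∈ RI, ∀ β : QuaternionAlgebra ℚ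 a 0 b, IsUnit β → φ (J.map (AddMonoidHom.mulLeft β).toIntLinearMap) = φ J) ∧ (∀ q : ℕ, q.Prime → ¬ q ∣ V.conductorNorm ℤ → ∀ J ∈ RI, ∑ᶠ J' ∈ {J' : Submodule ℤ (QuaternionAlgebra ℚ a 0 b) | J' ≤ J ∧ J'.toAddSubgroup.relIndex J.toAddSubgroup = q ^ 2 ∧ ∀ y ∈ J', ∀ x ∈ O, y * x ∈ J'}, φ J' = (V.frobeniusTrace q : ℤ) * φ J) ∧ (∃ J ∈ RI, ¬ (p : ℤ) ∣ φ J)) ∧ (I ∈ RI ∧ (∀ x : NumberField.RingOfIntegers K, ∀ y ∈ I, ψ (x : K) * y ∈ I) ∧ (∀ x : K, (∀ y ∈ I, ψ x * y ∈ I) → ∃ z : NumberField.RingOfIntegers K, (z : K) = x) ∧ (∀ 𝔞 : ClassGroup (NumberField.RingOfIntegers K), ClassGroup.mk0 (rep 𝔞) = 𝔞) ∧ (∀ 𝔞 : ClassGroup (NumberField.RingOfIntegers K), Submodule.span ℤ ((fun x : NumberField.RingOfIntegers K => ψ (x : K)) '' ((rep 𝔞 : nonZeroDivisors (Ideal (NumberField.RingOfIntegers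 K))) : Ideal (NumberField.RingOfIntegers K))) * I ∈ RI)) ∧ (1 ≤ m ∧ orderOf σ = p ^ m ∧ ¬ p ^ (m + 1) ∣ Fintype.card (ClassGroup (NumberField.RingOfIntegers K)) ∧ (∀ 𝔞 : ClassGroup (NumberField.RingOfIntegers K), dlog 𝔞 < p ^ m ∧ Nat.Coprime (orderOf (𝔞 * (σ ^ dlog 𝔞)⁻¹)) p))) ∧ ∃ k : ℕ, k ≤ V.analyticRank ∧ k + 2 ≤ p ∧ ¬ (p : ℤ) ∣ ∑ 𝔞 : ClassGroup (NumberField.RingOfIntegers K), ((dlog 𝔞).choose k : ℤ) * φ (Submodule.span ℤ ((fun x : NumberField.RingOfIntegers K => ψ (x : K)) '' ((rep 𝔞 : nonZeroDivisors (Ideal (NumberField.RingOfIntegers K))) : Ideal (NumberField.RingOfIntegers K))) * I)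

/-- item stmt-BirchSwinnertonDyer-17173 · crux · rank 3 · open · by planner
why it might fail: Rank-0 bound length Ш(A_χ/K)[𝔓^∞] ≤ 2v_𝔓(S_χ) at 𝔓 ∣ p = ord χ, p ∣ h_K, is unprinted (LV2010 1.2 excludes 𝔓 ∣ L_alg; Kim2024 5.23 has trivial χ; BCK drop the torsion of G̃_∞); an inline side condition (Eichler/RI, embedding, T_q typing) may mis-state — then misstated, not false.
sources: MazurRubin2007, Kim2024, BertoliniDarmon2005, arXiv:0806.4267, doi:10.4153/cjm-2011-077-6, ChidaHsieh2014
[crux] ONE INTEGER CAPS THE SELMER CORANK (card K2 + P2 + P3, both signs). For every elliptic E/ℚ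
(globally minimal W) and every admissible datum as in GrossMomentSharpness (same side conditions,
universally quantified) and every k ≤ p − 2: if p ∤ M_k then corank_{ℤ_p} Sel_{p^∞}(E/ℚ) ≤ k.
Intended proof: p ∤ M_k with k ≤ p−2 ⇒ v := v_𝔓(S_χ) = min{j : p ∤ M_j} ≤ k and S_χ ≠ 0 ⇒
L(E/K,χ^i,1) ≠ 0 for all i (Gross–Waldspurger, Galois-conjugate values) ⇒ the unramified order-p
twin A_χ/K has Mordell–Weil rank 0 and M = Sel_{𝔓^∞}(A_χ/K) = Ш(A_χ/K)[𝔓^∞] finite (BD2005 /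
Longo–Vigni / Nekovář) with length_𝒪 M ≤ 2v (rank-0 𝔓-part of BSD, upper bound = Euler-system
direction; Kim2024 Thm 5.23 is the trivial-character prototype: length = 2·v_p(toric period));
freezing (MR Prop 1.3: Raynaud at v ∣ p since p ≥ 5 unramified in K, H¹(K_v,E[p]) = 0 at v ∣ N from
p ∤ (q²−1)·v_q(j), E(L)[p] = 0 from surjectivity) gives M[𝔓] = Sel_p(E/K) = Sel_p(E/ℚ) ⊕
Sel_p(E^{D_K}/ℚ) =: V⁺ ⊕ V⁻; the Cassels–Tate–Flach form on M is perfect skew-Hermitian and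
Gal(K/ℚ)-equivariant with c acting on 𝒪 = ℤ[ζ_p] by ι, and ι ≡ −1 on 𝔓^{-1}𝒪/𝒪, so its shadow b on
M[𝔓] satisfies b(cx,cy) = −b(x,y): V⁺, V⁻ are b-isotropic, ra -/
@[route_item "route-BirchSwinnertonDyer-FrozenTwin", crux]
def FrozenTwinBound : Prop :=
  ∀ (V : WeierstrassCurve ℚ) [V.IsElliptic] [V.IsGloballyMinimal] (p : ℕ) [Fact p.Prime] (Nplus Nminus m : ℕ) (a b : ℚ) (O : Subring (QuaternionAlgebra ℚ a 0 b)) (K : Type) [Field K] [NumberField K] (ψ : K →ₐ[ℚ] QuaternionAlgebra ℚ a 0 b) (I : Submodule ℤ (QuaternionAlgebra ℚ a 0 b)) (φ : Submodule ℤ (QuaternionAlgebra ℚ a 0 b) → ℤ) (rep : ClassGroup (NumberField.RingOfIntegers K) → nonZeroDivisors (Ideal (NumberField.RingOfIntegers K))) (RI : Set (Submodule ℤ (QuaternionAlgebra ℚ a 0 b))) (σ : ClassGroup (NumberField.RingOfIntegers K)) (dlog : ClassGroup (NumberField.RingOfIntegers K) → ℕ), ((5 ≤ p ∧ V.HasGoodReductionAtPrime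 p ∧ ¬ (p : ℤ) ∣ V.frobeniusTrace p ∧ V.HasSurjectiveModNGaloisRep p ∧ (∀ q : ℕ, q.Prime → q ∣ V.conductorNorm ℤ → ¬ (p : ℤ) ∣ (q : ℤ) ^ 2 - 1) ∧ (∀ (q : ℕ) (_ : Fact q.Prime), V.HasMultiplicativeReductionAtPrime q → ¬ (p : ℤ) ∣ padicValRat q V.j)) ∧ (Module.finrank ℚ K = 2 ∧ NumberField.IsTotallyComplex K ∧ NumberField.discr K < -4 ∧ Int.gcd (NumberField.discr K) (V.conductorNorm ℤ * p) = 1) ∧ (V.conductorNorm ℤ = Nplus * Nminus ∧ Nat.Coprime Nplus Nminus ∧ Squarefree Nminus ∧ Odd Nminus.primeFactors.card ∧ (∀ q : ℕ, q.Prime → q ∣ Nplus → ((Ideal.span {(q : ℤ)}).primesOver (NumberField.RingOfIntegers K)).ncard = 2) ∧ (∀ q : ℕ, q.Prime → q ∣ Nminus → ((Ideal.span {(q : ℤ)}).primesOver (NumberField.RingOfIntegers K)).ncard = 1)) ∧ (a < 0 ∧ b < 0 ∧ (∀ (q : ℕ) [Fact q.Prime], (∀ x : QuaternionAlgebra ℚ_[q]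 (a : ℚ_[q]) 0 (b : ℚ_[q]), x ≠ 0 → IsUnit x) ↔ q ∣ Nminus)) ∧ (∃ O₁ O₂ : Subring (QuaternionAlgebra ℚ a 0 b), (∀ S : Subring (QuaternionAlgebra ℚ a 0 b), (S = O₁ ∨ S = O₂) → (S.toAddSubgroup.FG ∧ (∀ d : QuaternionAlgebra ℚ a 0 b, ∃ n : ℤ, n ≠ 0 ∧ n • d ∈ S) ∧ ∀ S' : Subring (QuaternionAlgebra ℚ a 0 b), S'.toAddSubgroup.FG → S ≤ S' → S' = S)) ∧ O = O₁ ⊓ O₂ ∧ O.toAddSubgroup.relIndex O₁.toAddSubgroup = Nplus) ∧ (∀ J : Submodule ℤ (QuaternionAlgebra ℚ a 0 b), J ∈ RI ↔ (J.FG ∧ (∀ d : QuaternionAlgebra ℚ a 0 b, ∃ n : ℤ, n ≠ 0 ∧ n • d ∈ J) ∧ (∀ x : QuaternionAlgebra ℚ a 0 b, (∀ y ∈ J, y * x ∈ J) ↔ x ∈ O) ∧ (∃ J' : Submodule ℤ (QuaternionAlgebra ℚ a 0 b), (∀ x : QuaternionAlgebra ℚ a 0 b, x ∈ J * J' ↔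 ∀ y ∈ J, x * y ∈ J) ∧ (∀ x : QuaternionAlgebra ℚ a 0 b, x ∈ J' * J ↔ x ∈ O)))) ∧ ((∀ J ∈ RI, ∀ β : QuaternionAlgebra ℚ a 0 b, IsUnit β → φ (J.map (AddMonoidHom.mulLeft β).toIntLinearMap) = φ J) ∧ (∀ q : ℕ, q.Prime → ¬ q ∣ V.conductorNorm ℤ → ∀ J ∈ RI, ∑ᶠ J' ∈ {J' : Submodule ℤ (QuaternionAlgebra ℚ a 0 b) | J' ≤ J ∧ J'.toAddSubgroup.relIndex J.toAddSubgroup = q ^ 2 ∧ ∀ y ∈ J', ∀ x ∈ O, y * x ∈ J'}, φ J' = (V.frobeniusTrace q : ℤ) * φ J) ∧ (∃ J ∈ RI, ¬ (p : ℤ) ∣ φ J)) ∧ (I ∈ RI ∧ (∀ x : NumberField.RingOfIntegers K, ∀ y ∈ I, ψ (x : K) * y ∈ I) ∧ (∀ x : K, (∀ y ∈ I, ψ x * y ∈ I) → ∃ z : NumberField.RingOfIntegers K, (z : K) = x) ∧ (∀ 𝔞 : ClassGroup (NumberField.RingOfIntegers K), ClassGroup.mk0 (rep 𝔞) = 𝔞)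 ∧ (∀ 𝔞 : ClassGroup (NumberField.RingOfIntegers K), Submodule.span ℤ ((fun x : NumberField.RingOfIntegers K => ψ (x : K)) '' ((rep 𝔞 : nonZeroDivisors (Ideal (NumberField.RingOfIntegers K))) : Ideal (NumberField.RingOfIntegers K))) * I ∈ RI)) ∧ (1 ≤ m ∧ orderOf σ = p ^ m ∧ ¬ p ^ (m + 1) ∣ Fintype.card (ClassGroup (NumberField.RingOfIntegers K)) ∧ (∀ 𝔞 : ClassGroup (NumberField.RingOfIntegers K), dlog 𝔞 < p ^ m ∧ Nat.Coprime (orderOf (𝔞 * (σ ^ dlog 𝔞)⁻¹)) p))) → ∀ k : ℕ, k + 2 ≤ p → ¬ (p : ℤ) ∣ ∑ 𝔞 : ClassGroup (NumberField.RingOfIntegers K), ((dlog 𝔞).choose k : ℤ) * φ (Submodule.span ℤ ((fun x : NumberField.RingOfIntegers K => ψ (x : K)) '' ((rep 𝔞 : nonZeroDivisors (Ideal (NumberField.RingOfIntegers K))) : Ideal (NumberField.RingOfIntegers K))) * I) → V.selmerCorank p ≤ k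

/-- item stmt-BirchSwinnertonDyer-15878 · crux · rank 4 · open · by planner
why it might fail: It is SelmerRankUB on the integral-j class: open from corank 4 exactly as there; no definite Gross-point setting exists for these curves (ε(E/K) = −1 for every coprime imaginary K when all conductor exponents are even), so the certificate has no grip.
sources: Zhang2014, Kato2004, SkinnerUrban2014, BurungaleEtAl2026
[crux] the POTENTIALLY-GOOD SECTOR (no prime of multiplicative reduction, i.e. integral j: the
definite setting of ToricShedding needs an odd number of inert multiplicative primes): for such E
(globally minimal W) and every good ordinary p ≥ 5 with ρ̄ surjective, corank Sel_{p^∞}(E/ℚ) ≤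
r_an(E). Intended mechanism: the same shedding in the Heegner setting N⁻ = 1 (Kolyvagin's derived
classes on X₀(N); Kolyvagin–Zhang structure theorem Zhang2014 Thm 4.7 / WZhang2014: κ ≠ 0 ⇒ max
r_p^± = ord κ + 1) once Heegner points of conductor n are a tree notion (definition request D1).
[difficulty: open-problem] -/
@[route_item "route-BirchSwinnertonDyer-FrozenTwin", crux]
def UBPotentiallyGood : Prop :=
  ∀ (W : WeierstrassCurve ℚ) [W.IsElliptic] [W.IsGloballyMinimal], (¬ ∃ (q : ℕ) (_ : Fact q.Prime), W.HasMultiplicativeReductionAtPrime q) → ∀ (p : ℕ) [Fact p.Prime], 5 ≤ p → W.HasGoodReductionAtPrime p → ¬ (p : ℤ) ∣ W.frobeniusTrace p → W.HasSurjectiveModNGaloisRep p → W.selmerCorank p ≤ W.analyticRank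

/-- item stmt-BirchSwinnertonDyer-0131 · crux · rank 5 · open · by planner
why it might fail: Theorem for r_an ≤ 3 (BCS2025 1.1.2, BurungaleEtAl2026 Cor 1, p-parity); OPEN from r_an = 4: needs Selmer classes out of high-order vanishing; the certificate side only produces UPPER bounds.
sources: BurungaleEtAl2026, SkinnerUrban2014, Kato2004, arXiv:2412.20078
Lower bound half of p^∞-Selmer BSD under Skinner2020-type hypotheses. Known when r_an ≤ 3
(SkinnerUrban2014 Thm 2 corank-0 converse, Skinner2020 Thm A corank-1 converse, p-parity
DokchitserDokchitser2010). imports: Summits.BirchSwinnertonDyer.Statement,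
Literature.NumberTheory.EllipticCurves.{Selmer,Sha,Heights,GaloisAction,Tamagawa,BSDInvariants}
(routes/Sketch.lean, lean check rc 0 on 2026-08-13). -/
@[route_item "route-BirchSwinnertonDyer-FrozenTwin", crux]
def SelmerRankLB : Prop :=
  ∀ (W : WeierstrassCurve ℚ) [W.IsElliptic] [W.IsGloballyMinimal] (p : ℕ) [Fact p.Prime], 5 ≤ p → W.HasGoodReductionAtPrime p → ¬ (p : ℤ) ∣ W.frobeniusTrace p → W.HasSurjectiveModNGaloisRep p → W.analyticRank ≤ W.selmerCorank p

/-- item stmt-BirchSwinnertonDyer-0132 · crux · rank 6 · open · by planner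
why it might fail: Known only for r_an ≤ 1 (Kolyvagin1990 Thm A, Kato2004 Thm 14.2); for r_an ≥ 2 nothing excludes an infinitely divisible element of Ш at every p; the certificate kills Ш(E)[p] only at sharp (K,p), not at every p.
sources: Kolyvagin1990, Kato2004, SilvermanAEC2009, GreenbergLNM1716
p-primary Tate–Shafarevich finiteness (weaker than Literature.BSD.ShaFiniteConjecture, prime by
prime). Known when r_an ≤ 1 (Kolyvagin1990 Thm A; Kato2004 Thm 14.2 =
Literature.NumberTheory.EllipticCurves.kato_finite_of_L_one_ne_zero for r_an = 0). Tate1974 §1.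
imports: Summits.BirchSwinnertonDyer.Statement,
Literature.NumberTheory.EllipticCurves.{Selmer,Sha,Heights,GaloisAction,Tamagawa,BSDInvariants}
(routes/Sketch.lean, lean check rc 0 on 2026-08-13). -/
@[route_item "route-BirchSwinnertonDyer-FrozenTwin", crux]
def SelmerRankShaPFinite : Prop :=
  ∀ (W : WeierstrassCurve ℚ) [W.IsElliptic] (p : ℕ) [Fact p.Prime], Finite ↥(AddCommGroup.primaryComponent W.sha p)

/-- item stmt-BirchSwinnertonDyer-18086 · crux · rank 8 · open · by planner
why it might fail: Selmer-rank BSD for CM curves is open once min(corank_p, r_an) ≥ 2: Rubin's two-variable IMC bounds corank_p only by the order of a Katz p-adic L, whose comparison with r_an needs a non-degenerate CM p-adic height (Bertrand1982 = rank 1); r_an ≤ corank_p beyond p-parity has no engine.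
sources: Rubin1991MainConj (K. Rubin, Invent. Math. 103 (1991): two-variable main conjecture for CM curves), CoatesWiles1977; Rubin1987Sha (r_an = 0 slice), arXiv:2506.03465 (Burungale–Tian, Ann. of Math. 203 (2026) Thm 1.1: CM rank-0 p-converse) = Literature.NumberTheory.EllipticCurves.burungaleTian_analyticRank_eq_zero_of_selmerCorank_eq_zero_of_hasCM, doi:10.1007/s00222-019-00929-7 (Burungale–Tian, Invent. Math. 220 (2020): CM rank-1 p-converse, p > 3 good ordinary) = Literature.NumberTheory.EllipticCurves.burungaleTian_analyticRank_eq_one_of_selmerCorank_eq_one_of_hasCM, DokchitserDokchitserAnnals2010, Thm 1.4 (p-parity) = Literature.NumberTheory.EllipticCurves.selmerCorank_mod_two_eq, doi:10.5802/aif.2206 (Agboola–Howard, anticyclotomic Iwasawa theory of CM curves)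
[crux] CM SECTOR of SelmerRankSmallImage (stmt-BirchSwinnertonDyer-14418) — Selmer-rank BSD for
elliptic curves E/ℚ WITH COMPLEX MULTIPLICATION (globally minimal W, W.HasCM) at every prime p ≥ 5
of good ordinary reduction (the primes split in the CM field): corank_{ℤ_p} Sel_{p^∞}(E/ℚ) =
ord_{s=1} L(E,s). Filed by the route-choice planner (unit
rchoice-Summits-BirchSwinnertonDyer-Bi-aee6ff5b, 2026-08-17; payload.route_choice on
Theorems/TangentConeSelmerRankSmallImageReduction.lean, p146239, whose hypothesis
burungaleTian_analyticRank_eq_zero_of_selmerCorank_eq_zero_of_hasCM is an XL-apex non-crux fact) as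
the RE-ROUTE: with Serre's open image theorem PROVED in tree
(Literature.NumberTheory.EllipticCurves.serre_open_image_holds) every non-CM curve has a big-image
good ordinary prime q ≥ 5 (Theorems.exists_goodOrdinary_surjective_of_not_hasCM, landed), where this
route's own big-image items give corank_q = r_an, and the route's Ш item(s) transfer the corank to
any other prime through Greenberg's proved identity corank Sel_{p^∞} = rank + corank Ш[p^∞]; hence
the small-image crux costs, beyond items the route already carries, EXACTLY this statement and
NOTHING from the literature — the -/
@[route_item "route-BirchSwinnertonDyer-FrozenTwin", crux]
def SelmerRankCM : Prop :=
  ∀ (W : WeierstrassCurve ℚ) [W.IsElliptic] [W.IsGloballyMinimal] (p : ℕ) [Fact p.Prime], 5 ≤ p → W.HasGoodReductionAtPrime p → ¬ (p : ℤ) ∣ W.frobeniusTrace p → W.HasCM → W.selmerCorank p = W.analyticRank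

/-- item stmt-BirchSwinnertonDyer-1068 · support · rank 9 · open · by planner
[support] needs-fact: WeierstrassCurve.hasEntireLFunction_rat
(Literature/NumberTheory/EllipticCurves/AnalyticRank.lean:176) — for every elliptic E/ℚ, L(E,s) = Σ
aₙ n⁻ˢ extends to an entire function (Wiles1995; BCDTJAMS2001 Thm A + Hecke; SilvermanAEC2009 Thm
C.16.3). The route's ONLY unproved cone fact and its standing hypothesis hE:
WeierstrassCurve.analyticRank := analyticOrderNatAt W.entireLFunction 1 is a junk value without it,
and it enters the import cone through Summits/BirchSwinnertonDyer/BirchSwinnertonDyer/Statement.lean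
itself, so no route of the summit can be stated around it. Tier-0 literature debt, already reduced
in tree to the modularity fact
Literature.NumberTheory.EllipticCurves.ModularForms.exists_isNewformOf
(WeierstrassCurve.hasEntireLFunction_rat_of_exists_isNewformOf,
AnalyticRankModularityProofs.lean:209, kernel-clean: propext/Classical.choice/Quot.sound); what
remains is the Modularity Theorem itself (XL; no formalisation exists). First antecedent of
Assembly; every other item of the route carries it as hypothesis. Closes by `theorem … :
EntireContinuation := WeierstrassCurve.hasEntireLFunction_rat_holds` once that lands. Not a crux: a
theorem in print; pr -/
@[route_item "route-BirchSwinnertonDyer-FrozenTwin"]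
def EntireContinuation : Prop :=
  ∀ (W : WeierstrassCurve ℚ) [W.IsElliptic], W.HasEntireLFunction

/-- item stmt-BirchSwinnertonDyer-17959 · support · rank 9 · closed · proved by Summit.BirchSwinnertonDyer.BirchSwinnertonDyer.Theorems.frozenTwin_serrePrimeSupply_proof @ 95fa61c19ef9 (prover) · by planner
[support] SERRE PRIME SUPPLY (literature leaf, PROVED in tree; closable today by a one-line Theorems
file): every NON-CM elliptic curve E/ℚ (global minimal model W) has a prime p ≥ 5 of good ORDINARY
reduction at which the mod-p Galois representation is SURJECTIVE — Serre 1972 §4.2 Thm 2 (open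
image) + infinitely many good ordinary primes (Serre 1981 §8). Tree proof:
Summit.BirchSwinnertonDyer.BirchSwinnertonDyer.Theorems.exists_goodOrdinary_surjective_of_not_hasCM
(Theorems/TangentConeSelmerRankSmallImageReduction.lean, p146239) =
Literature.NumberTheory.EllipticCurves.serre_open_image_holds (SerreOpenImageFinalProofs) +
WeierstrassCurve.infinite_goodOrdinaryPrimes_holds (SupersingularDensityProofs); close it with
`theorem serrePrimeSupply : <Route>.SerrePrimeSupply := fun W _ _ h =>
Summit.BirchSwinnertonDyer.BirchSwinnertonDyer.Theorems.exists_goodOrdinary_surjective_of_not_hasCM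
W h`. WHY AN ITEM (route-choice repair rchoice-de55961e, 2026-08-17): it is the PRIME SWITCH that
lets the deciding theorem consume the CM crux SelmerRankCM (stmt-BirchSwinnertonDyer-18086) instead
of SelmerRankSmallImage (stmt-14418, now support): non-CM curve → this big-image prime and the
route's own -/
@[route_item "route-BirchSwinnertonDyer-FrozenTwin", crux]
def SerrePrimeSupply : Prop :=
  ∀ (W : WeierstrassCurve ℚ) [W.IsElliptic] [W.IsGloballyMinimal], ¬ W.HasCM → ∃ (p : ℕ) (_ : Fact p.Prime), 5 ≤ p ∧ W.HasGoodReductionAtPrime p ∧ ¬ (p : ℤ) ∣ W.frobeniusTrace p ∧ W.HasSurjectiveModNGaloisRep p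

-- `SerrePrimeSupply` holds: proved by `Summit.BirchSwinnertonDyer.BirchSwinnertonDyer.Theorems.frozenTwin_serrePrimeSupply_proof` @ 95fa61c19ef9 (its module imports this route file, so no `_holds` link can be stated here).

-- earlier Assembly (stmt-BirchSwinnertonDyer-17174, replaced 2026-08-17T09:19:40Z -> stmt-BirchSwinnertonDyer-17961): retired by None — GrossMomentSharpness → FrozenTwinBound → UBPotentiallyGood → SelmerRankLB → SelmerRankShaPFinite → SelmerRankSmallImage → _root_.BirchSwinnertonDyer
/-- item stmt-BirchSwinnertonDyer-17961 · assembly · rank 1 · open · by planner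
sources: MazurRubin2007, Kim2024, GreenbergLNM1716
[assembly] the TYPE of the re-glued deciding theorem (route-repair 2026-08-17, CM re-route):
GrossMomentSharpness → FrozenTwinBound → UBPotentiallyGood → SelmerRankLB → SelmerRankShaPFinite →
SelmerRankCM → SerrePrimeSupply → BirchSwinnertonDyer (closable by `fun a b c d e f g => closes a b
c d e f g`). Replaces the rev-3 assembly … → SelmerRankSmallImage → BirchSwinnertonDyer: the
small-image binder SelmerRankSmallImage (stmt-14418, re-badged support by rchoice-de55961e) is
dropped from THIS route — beyond the route's own items it costs exactly the CM crux SelmerRankCM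
(stmt-18086) plus the proved Serre prime (SerrePrimeSupply), and it is a COROLLARY of the new
hypothesis set (planner Sketch.lean `smallImage_of_newBinders`, lean rc 0: CM → SelmerRankCM; non-CM
→ corank is prime-independent under SelmerRankShaPFinite by Greenberg's identity, and equals r_an at
the certificate prime resp. the Serre prime). -/
@[route_item "route-BirchSwinnertonDyer-FrozenTwin"]
def Assembly : Prop :=
  GrossMomentSharpness → FrozenTwinBound → UBPotentiallyGood → SelmerRankLB → SelmerRankShaPFinite → SelmerRankCM → SerrePrimeSupply → _root_.BirchSwinnertonDyer

/-! D-0027 §2.1 — DECIDING THEOREM (planner-authored via `route open/edit --closes-file`; by planner-rrepair-BirchSwinnertonDyer-FrozenTwin-db3f67d4-0 2026-08-17T09:19:40Z):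
its hypotheses are this route's items and its conclusion the sub-problem Statement (glue_lint), and it elaborates with this file. -/

@[closes "route-BirchSwinnertonDyer-FrozenTwin"] theorem closes (hK1 : GrossMomentSharpness) (hK2 : FrozenTwinBound) (hPG : UBPotentiallyGood)
    (hLB : SelmerRankLB) (hSha : SelmerRankShaPFinite) (hCM : SelmerRankCM) (hSerre : SerrePrimeSupply) :
    _root_.BirchSwinnertonDyer := by
  -- Bookkeeping: Greenberg's corank identity (proved), shaCorank = 0 for finite Ш[p^∞] (proved), a global
  -- minimal model (proved), a good ordinary p ≥ 5 (proved), isomorphism invariance of rank / Euler factors /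
  -- analytic rank (T1–T3, re-derived exactly as in routes SelmerRank / ToricShedding), and
  -- selmerCorank_identity_imp_thesis_imp_bsd. Selmer-rank BSD at ONE prime in three sectors: (a) a
  -- multiplicative prime — GrossMomentSharpness supplies an admissible datum (p, K, χ-data) and k ≤ r_an(E)
  -- with p ∤ M_k, FrozenTwinBound turns p ∤ M_k into corank Sel_{p^∞}(E/ℚ) ≤ k, SelmerRankLB gives equality;
  -- (b) integral j, no CM — the Serre big-image good ordinary prime of SerrePrimeSupply, where
  -- UBPotentiallyGood ∧ SelmerRankLB give corank = r_an; (c) CM — any good ordinary p ≥ 5 (proved supply)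
  -- and SelmerRankCM.
  have hId : ∀ (W : WeierstrassCurve ℚ), W.selmerCorank_eq_mordellWeilRank_add :=
    fun W => W.selmerCorank_eq_mordellWeilRank_add_holds
  have hZ : ∀ (W : WeierstrassCurve ℚ) [W.IsElliptic] (p : ℕ) [Fact p.Prime],
      Finite ↥(AddCommGroup.primaryComponent W.sha p) → W.shaCorank p = 0 :=
    Literature.BSD.shaCorank_eq_zero_of_finite
  -- (T1) the Mordell–Weil rank is an isomorphism invariant (AEC III.3.1(b); `VariableChangePoints`)
  have hMW : ∀ (W : WeierstrassCurve ℚ) (C : WeierstrassCurve.VariableChange ℚ),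
      (C • W).mordellWeilRank = W.mordellWeilRank := fun W C =>
    @WeierstrassCurve.VariableChange.finrank_point_variableChange ℚ _ W C (Classical.decEq ℚ)
  -- (T2) the local Euler factor is an isomorphism invariant (AEC VII.1.3(b), VII.2, VII.5.1, C §16)
  have hloc : ∀ (R : Type) [CommRing R] [IsDomain R] [IsDiscreteValuationRing R]
      (K : Type) [Field K] [Algebra R K] [IsFractionRing R K]
      (W : WeierstrassCurve K) [W.IsElliptic] (C : WeierstrassCurve.VariableChange K),
      (C • W).localEulerFactor R = W.localEulerFactor R := by
    intro R _ _ _ K _ _ _ W _ C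
    obtain ⟨D, hD⟩ : ∃ D : WeierstrassCurve.VariableChange K,
        (C • W).minimal R = D • W.minimal R :=
      ⟨((C • W).exists_isMinimal R).choose * C * ((W.exists_isMinimal R).choose)⁻¹, by
        rw [WeierstrassCurve.minimal, WeierstrassCurve.minimal, mul_smul, mul_smul, inv_smul_smul]⟩
    haveI hE : (W.minimal R).IsElliptic := by rw [WeierstrassCurve.minimal]; infer_instance
    have hΔ : (W.minimal R).Δ ≠ 0 := (W.minimal R).isUnit_Δ.ne_zero
    have hgood : ((C • W).minimal R).HasGoodReduction R ↔ (W.minimal R).HasGoodReduction R := by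
      rw [WeierstrassCurve.hasGoodReduction_iff, WeierstrassCurve.hasGoodReduction_iff,
        WeierstrassCurve.valuation_Δ_eq_of_isMinimal_of_eq_smul R hD]
      exact and_congr_left' ⟨fun _ => inferInstance, fun _ => inferInstance⟩
    have hcard : Nat.card (((C • W).minimal R).reduction R).toAffine.Point =
        Nat.card ((W.minimal R).reduction R).toAffine.Point := by
      obtain ⟨E, hE⟩ := WeierstrassCurve.exists_reduction_eq_smul R hD hΔ
      rw [hE]
      exact WeierstrassCurve.natCard_point_smul _ _
    have hpoly : (C • W).localPolynomial R = W.localPolynomial R := by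
      classical
      unfold WeierstrassCurve.localPolynomial
      simp only [hgood, hcard,
        WeierstrassCurve.hasSplitMultiplicativeReduction_iff_of_isMinimal_of_eq_smul R hD hΔ,
        WeierstrassCurve.hasMultiplicativeReduction_iff_of_isMinimal_of_eq_smul R hD hΔ]
    simp only [WeierstrassCurve.localEulerFactor, WeierstrassCurve.localPowerSeries, hpoly]
  -- (T3) hence the analytic rank is an isomorphism invariant (AEC App. C §16)
  have hAn : ∀ (W : WeierstrassCurve ℚ) [W.IsElliptic] (C : WeierstrassCurve.VariableChange ℚ),
      (C • W).analyticRank = W.analyticRank := by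
    intro W _ C
    have hL : (C • W).LFunction = W.LFunction := by
      unfold WeierstrassCurve.LFunction
      congr 1
      funext v
      simp only [WeierstrassCurve.baseChange, ← WeierstrassCurve.map_variableChange]
      exact hloc _ _ _ _
    have hLS : (C • W).LSeries = W.LSeries := by
      funext s
      simp only [WeierstrassCurve.LSeries, hL]
    have hEC : (C • W).entireContinuations = W.entireContinuations := by
      simp only [WeierstrassCurve.entireContinuations, hLS]
    have hEL : (C • W).entireLFunction = W.entireLFunction := by
      unfold WeierstrassCurve.entireLFunction
      rw [hEC, hLS]
    simp only [WeierstrassCurve.analyticRank, hEL]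
  -- Selmer-rank BSD at ONE prime on a global minimal model, in three sectors
  have hmin : ∀ (V : WeierstrassCurve ℚ) [V.IsElliptic] [V.IsGloballyMinimal],
      ∃ (p : ℕ) (_ : Fact p.Prime), V.selmerCorank p = V.analyticRank := by
    intro V _ _
    by_cases hm : ∃ (q : ℕ) (_ : Fact q.Prime), V.HasMultiplicativeReductionAtPrime q
    · -- (a) a multiplicative prime: the Gross-moment certificate at the frozen-twin prime
      obtain ⟨p, hp, Nplus, Nminus, m, a, b, O, K, hFK, hNK, ψ, I, φ, rep, RI, σ, dlog, hC, k, hkr,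
        hkp, hndvd⟩ := hK1 V hm
      obtain ⟨⟨h5, hgood, hord, hsurj, hq2, hj⟩, hrest⟩ := hC
      have hk : V.selmerCorank p ≤ k :=
        hK2 V p Nplus Nminus m a b O K ψ I φ rep RI σ dlog ⟨⟨h5, hgood, hord, hsurj, hq2, hj⟩, hrest⟩
          k hkp hndvd
      have hUB : V.selmerCorank p ≤ V.analyticRank := hk.trans hkr
      exact ⟨p, hp, le_antisymm hUB (hLB V p h5 hgood hord hsurj)⟩
    · by_cases hW : V.HasCM
      · -- (c) CM (integral j automatically): any good ordinary p ≥ 5, then SelmerRankCM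
        obtain ⟨p, hp, h5, hgood, hord⟩ := WeierstrassCurve.exists_good_ordinary_prime_holds V
        exact ⟨p, hp, hCM V p h5 hgood hord hW⟩
      · -- (b) potentially good everywhere, no CM: the Serre big-image good ordinary prime
        obtain ⟨p, hp, h5, hgood, hord, hsurj⟩ := hSerre V hW
        exact ⟨p, hp, le_antisymm (hPG V hm p h5 hgood hord hsurj) (hLB V p h5 hgood hord hsurj)⟩
  -- transport to an arbitrary model and assemble
  refine Literature.BSD.selmerCorank_identity_imp_thesis_imp_bsd hId ?_
  intro W _
  obtain ⟨C, hC⟩ := WeierstrassCurve.hasGlobalMinimalModel_rat_holds W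
  obtain ⟨p, hp, hminp⟩ := hmin (C • W)
  refine ⟨p, hp.out, ?_, hZ W p (hSha W p)⟩
  have h1 : W.selmerCorank p = W.mordellWeilRank + W.shaCorank p := hId W p
  have h2 : (C • W).selmerCorank p = (C • W).mordellWeilRank + (C • W).shaCorank p := hId (C • W) p
  have h3 : W.shaCorank p = 0 := hZ W p (hSha W p)
  have h4 : (C • W).shaCorank p = 0 := hZ (C • W) p (hSha (C • W) p)
  have h6 := hMW W C
  have h7 := hAn W C
  omega

end Summit.BirchSwinnertonDyer.BirchSwinnertonDyer.Theses.FrozenTwin
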